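import Literature.AlgebraicGeometry.Motives.AbelianVarietyDivisionField
import Literature.AlgebraicGeometry.Motives.AbelianVarietyTorsionPointsAlgClosed
import Literature.AlgebraicGeometry.Motives.ZetaFunctionProofs
import HarnessLib

/-!
# Torsion points of an abelian variety are rational over a finite extension
# (Shimura 1998, §19.1 «the smallest extension of `k` over which all the points of `A[N]` are rational»;
# Serre–Tate 1968, §1; §18.6 p. 167 «take a finite Galois extension … over which … the points of `A[N]` are rational»)

Topic `Literature/AlgebraicGeometry/Motives`, namespaces `Literature.AlgebraicGeometry.Motives.AlgPoints` and
`Literature.AlgebraicGeometry.Motives.AbelianVariety`.  THEOREMS ONLY: no definition, no named fact, no instance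
(net Literature debt 0).  Cell `hodgecm-mathlib` (D-0151), fan B-II row II-1, piece **S7a-G2 «TORSION»** of B-p12's
decomposition of `levelStructure` (Shimura 1998, proof of Thm. 18.6, p. 167: the auxiliary number field `L₁` over which
`A`, its conjugates, their homomorphisms AND the points of `A[N]` are rational); the S7a-currency corollary
(`(A₀ ⊗ L′) ⊗ ℂ`, `pointsMulEquiv`, `baseChangeTowerIso`) is B-p16's `MainTheoremCMLevelTorsionField`, which consumes
`AbelianVariety.exists_intermediateField_forall_torsionPoints_complex` below by name.

## What is here

* §1 `AlgPoints.extendScalars_extendScalars'` — transitivity of extension of scalars of points along a tower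
  `k → E → M → Ω` (the tree's `extendScalars_extendScalars` is the case `E = k`);
  `AlgPoints.exists_extendScalars_eq_of_forall_mem_fixingSubgroup_smul_eq` — **Galois descent of a `k̄`-point to an
  intermediate field** `E ⊆ k̄` (`k` perfect): a point of `X(k̄)` fixed by `Gal(k̄/E)` comes from `X(E)` (the values of
  its residue embedding are `Gal(k̄/E)`-fixed, hence in `E` by Krull's correspondence
  `InfiniteGalois.fixedField_fixingSubgroup`; then the tree's descent along a field embedding
  `AlgPoints.mem_range_precomp`).
* §2 `AbelianVariety.mem_torsionPoints_of_extendScalars_mem` (torsion is detected after an extension of scalars) and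
  **`AbelianVariety.exists_extendScalars_eq_of_divisionField_le` — `A[N](k̄) ⊆ A(E)` for every `E ⊇ k(A[N])`**, the
  defining property of the `N`-division field `AbelianVariety.divisionField` of the tree
  (`Motives/AbelianVarietyDivisionField`: there `k(A[N])` is the fixed field of the pointwise stabiliser of `A[N](k̄)`
  and `mem_fixingSubgroup_divisionField_iff`/`divisionField_le_iff` are proved; the rationality statement itself was
  not yet recorded).
* §3 **`AbelianVariety.exists_intermediateField_forall_torsionPoints_complex_of_subset_range`** and
  **`AbelianVariety.exists_intermediateField_forall_torsionPoints_complex`** — for an abelian variety `A₀` over a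
  field `L ⊂ ℂ` of characteristic `0` and `N ≠ 0` there is a FINITE GALOIS `L′/L` inside `ℂ` (namely the image of
  `L(A₀[N]) ⊆ L̄` under an `L`-embedding `L̄ → ℂ`) such that for EVERY field `M` between `L` and `ℂ` whose image
  contains `L′` (Type form: `(L′ : Set ℂ) ⊆ range (M → ℂ)`; IntermediateField form: `L′ ≤ M`, upward closed so that
  S7a-G1 may enlarge `L′` to its common field `L₁`) every `N`-torsion point of `A₀(ℂ)` is the extension of scalars of
  an `N`-torsion point of `A₀(M)`.  Inputs: `A₀[N](ℂ) = A₀[N](L̄)_ℂ` (`exists_extendScalars_eq_of_mem_torsionPoints`,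
  `Motives/AbelianVarietyTorsionPointsAlgClosed`: both have `N^{2 dim}` points) and §2.

## References

* [Shimura1998] G. Shimura, *Abelian Varieties with Complex Multiplication and Modular Functions*, Princeton 1998,
  §19.1 (the field `k(A[N])`), §18.6 proof of Thm. 18.6, p. 167.
* [SerreTate1968] J.-P. Serre, J. Tate, *Good reduction of abelian varieties*, Ann. of Math. 88 (1968), §1
  (`A_m ⊂ A(K_s)`, `K(A_m)` finite Galois over `K`).
* [Hartshorne1977] R. Hartshorne, *Algebraic Geometry*, II Ex. 2.7, Ex. 4.7 (points with values in a field and the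
  Galois action on them).
-/

set_option autoImplicit false

noncomputable section

open CategoryTheory AlgebraicGeometry

universe u

namespace Literature.AlgebraicGeometry.Motives

/-! ## §1. Towers and Galois descent of points to an intermediate field -/

namespace AlgPoints

section Tower

variable {k : Type u} [Field k] (X : SchemeOver k) (E M Ω : Type u) [Field E] [Field M] [Field Ω]
  [Algebra k E] [Algebra k M] [Algebra k Ω] [Algebra E M] [Algebra M Ω] [Algebra E Ω]
  [IsScalarTower k E M] [IsScalarTower k M Ω] [IsScalarTower k E Ω] [IsScalarTower E M Ω]

/-- **Transitivity of extension of scalars of points** along a tower of fields `k → E → M → Ω`: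
`(P_M)_Ω = P_Ω` for `P ∈ X(E)` (`Spec Ω → Spec M → Spec E` is `Spec` of the composite embedding).
[cite: Hartshorne1977, II Ex. 2.7] -/
theorem extendScalars_extendScalars' (P : AlgPoints X E) :
    extendScalars X M Ω (extendScalars X E M P) = extendScalars X E Ω P := by
  apply Over.OverMorphism.ext
  change Spec.map (CommRingCat.ofHom (algebraMap M Ω)) ≫ Spec.map (CommRingCat.ofHom (algebraMap E M)) ≫ P.left =
    Spec.map (CommRingCat.ofHom (algebraMap E Ω)) ≫ P.left
  rw [← Spec.map_comp_assoc, ← CommRingCat.ofHom_comp, ← IsScalarTower.algebraMap_eq E M Ω]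

end Tower

section Descent

variable {k : Type u} [Field k] [PerfectField k] {X : SchemeOver k}

/-- **Galois descent of a geometric point to an intermediate field.**  Let `k` be perfect, `E ⊆ k̄` an intermediate
field and `Q ∈ X(k̄)` a point fixed by every `σ ∈ Gal(k̄/E)`.  Then `Q = R_{k̄}` for a (unique) `R ∈ X(E)`: writing
`Q = (x, f : κ(x) → k̄)`, each value `f(t)` is fixed by `Gal(k̄/E)` (`AlgPoints.apply_resHom_of_smul_eq`), hence lies in
`E` because `E` is the fixed field of `Gal(k̄/E)` (Krull, `InfiniteGalois.fixedField_fixingSubgroup`); so `f` factors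
through `E` and `Q` comes from `X(E)` (`AlgPoints.mem_range_precomp`).  This is Serre–Tate's «`A_m ⊂ A(K_s)` … `K(A_m)`»
bookkeeping and Shimura's «rational over `k(A[N])`». [cite: SerreTate1968, §1] [cite: Shimura1998, §19.1]
[cite: Hartshorne1977, II Ex. 4.7] -/
theorem exists_extendScalars_eq_of_forall_mem_fixingSubgroup_smul_eq
    (E : IntermediateField k (AlgebraicClosure k)) (Q : AlgPoints X (AlgebraicClosure k))
    (hQ : ∀ σ : AlgebraicClosure k ≃ₐ[k] AlgebraicClosure k, σ ∈ E.fixingSubgroup → σ • Q = Q) :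
    ∃ R : AlgPoints X E, extendScalars X E (AlgebraicClosure k) R = Q := by
  haveI : IsGalois k (AlgebraicClosure k) := {}
  have hs : (specOverMap E (AlgebraicClosure k) :
      specOver k (AlgebraicClosure k) ⟶ specOver k E).left =
        Spec.map (CommRingCat.ofHom ((IsScalarTower.toAlgHom k E (AlgebraicClosure k) :
          E →ₐ[k] AlgebraicClosure k) : E →+* AlgebraicClosure k)) := rfl
  obtain ⟨R, hR⟩ := mem_range_precomp (X := X) hs Q (fun t => by
    have ht : Q.resHom t ∈ E := by
      rw [← InfiniteGalois.fixedField_fixingSubgroup E, IntermediateField.mem_fixedField_iff]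
      exact fun τ hτ => apply_resHom_of_smul_eq τ Q (hQ τ hτ) t
    exact ⟨⟨_, ht⟩, rfl⟩)
  exact ⟨R, hR⟩

end Descent

end AlgPoints

namespace AbelianVariety

/-! ## §2. `A[N](k̄) ⊆ A(k(A[N]))`: torsion points are rational over the division field -/

section Torsion

variable {k : Type u} [Field k] (A : AbelianVariety k) (M Ω : Type u) [Field M] [Field Ω] [Algebra k M]
  [Algebra k Ω] [Algebra M Ω] [IsScalarTower k M Ω]

/-- **Torsion is detected after extension of scalars**: if `Q_Ω ∈ A[n](Ω)` then `Q ∈ A[n](M)` (extension of scalars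
`A(M) → A(Ω)` is an injective group homomorphism, `AlgPoints.extendScalars_injective`). [cite: SerreTate1968, §1] -/
theorem mem_torsionPoints_of_extendScalars_mem {n : ℤ} {Q : A.Points M}
    (h : AlgPoints.extendScalars A.X M Ω Q ∈ A.torsionPoints Ω n) : Q ∈ A.torsionPoints M n := by
  rw [mem_torsionPoints_iff] at h ⊢
  apply AlgPoints.extendScalars_injective A.X M Ω
  have h1 : AlgPoints.extendScalarsMonoidHom A.X M Ω (Q ^ n) = AlgPoints.extendScalarsMonoidHom A.X M Ω 1 := by
    rw [map_zpow, map_one, AlgPoints.extendScalarsMonoidHom_apply, h]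
  simpa only [AlgPoints.extendScalarsMonoidHom_apply] using h1

end Torsion

section DivisionField

variable {k : Type u} [Field k] [PerfectField k] (A : AbelianVariety k) (N : ℕ) [NeZero N]

/-- **`A[N](k̄) ⊆ A(E)` for every intermediate field `E ⊇ k(A[N])`** (`k` perfect, `N ≠ 0`): each `N`-torsion point
`Q ∈ A[N](k̄)` is `R_{k̄}` for an `N`-torsion point `R ∈ A[N](E)`.  Indeed `Gal(k̄/E) ⊆ Gal(k̄/k(A[N]))` fixes `A[N](k̄)`
pointwise (`divisionField_le_iff`), so §1 applies; `R` is `N`-torsion by `mem_torsionPoints_of_extendScalars_mem`.  This is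
the rationality statement behind the name «`N`-division field»: «the smallest extension of `k` over which all the points
of `A[N]` are rational». [cite: Shimura1998, §19.1] [cite: SerreTate1968, §1] -/
theorem exists_extendScalars_eq_of_divisionField_le {E : IntermediateField k (AlgebraicClosure k)}
    (hE : A.divisionField N ≤ E) {Q : A.Points (AlgebraicClosure k)}
    (hQ : Q ∈ A.torsionPoints (AlgebraicClosure k) (N : ℤ)) :
    ∃ R ∈ A.torsionPoints E (N : ℤ), AlgPoints.extendScalars A.X E (AlgebraicClosure k) R = Q := by
  have hfix : ∀ σ : AlgebraicClosure k ≃ₐ[k] AlgebraicClosure k, σ ∈ E.fixingSubgroup → σ • Q = Q := by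
    intro σ hσ
    have h := (A.divisionField_le_iff N E).mp hE ((Field.absoluteGaloisGroup.toAlgEquiv k).symm σ) hσ
      (Additive.ofMul Q) ((mem_geomTorsion_iff _).mpr hQ)
    rw [← ofMul_smul, AlgPoints.absoluteGaloisGroup_smul_def, MulEquiv.apply_symm_apply] at h
    rw [AlgPoints.smul_def]
    exact Additive.ofMul.injective h
  obtain ⟨R, hR⟩ := AlgPoints.exists_extendScalars_eq_of_forall_mem_fixingSubgroup_smul_eq E Q hfix
  refine ⟨R, A.mem_torsionPoints_of_extendScalars_mem E (AlgebraicClosure k) ?_, hR⟩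
  rw [hR]
  exact hQ

/-- **`A[N](k̄) ⊆ A(k(A[N]))`**: the case `E = k(A[N])` of `exists_extendScalars_eq_of_divisionField_le`.
[cite: Shimura1998, §19.1] [cite: SerreTate1968, §1] -/
theorem exists_extendScalars_divisionField_eq {Q : A.Points (AlgebraicClosure k)}
    (hQ : Q ∈ A.torsionPoints (AlgebraicClosure k) (N : ℤ)) :
    ∃ R ∈ A.torsionPoints (A.divisionField N) (N : ℤ),
      AlgPoints.extendScalars A.X (A.divisionField N) (AlgebraicClosure k) R = Q :=
  A.exists_extendScalars_eq_of_divisionField_le N le_rfl hQ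

end DivisionField

/-! ## §3. Over `ℂ`: a finite Galois `L′/L` inside `ℂ` with `A₀[N](ℂ) ⊆ A₀(M)` for every `M ⊇ L′` -/

section Complex

variable {L : Type} [Field L] [CharZero L] [Algebra L ℂ] (A₀ : AbelianVariety L) {N : ℕ}

/-- **Torsion points of `A₀(ℂ)` are rational over a finite Galois extension of `L` inside `ℂ` — Type/range form.**
For `A₀` over a field `L ⊂ ℂ` of characteristic `0` and `N ≠ 0` there is an intermediate field `L ⊆ L′ ⊆ ℂ`, finite
and Galois over `L`, such that for every field `M` with `L → M → ℂ` whose image in `ℂ` contains `L′`, every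
`P ∈ A₀[N](ℂ)` is `Q_ℂ` for some `Q ∈ A₀[N](M)`.  Construction: `L′ = e(L(A₀[N]))` for an `L`-embedding `e : L̄ → ℂ`
(`IsAlgClosed.lift`); `P = (Q₀)_ℂ` with `Q₀ ∈ A₀[N](L̄)` (`exists_extendScalars_eq_of_mem_torsionPoints`: `A₀[N](L̄)` and
`A₀[N](ℂ)` both have `N^{2 dim A₀}` elements), `Q₀ = (Q₁)_{L̄}` with `Q₁ ∈ A₀[N](L(A₀[N]))` (§2), and `Q₁` is pushed
into `A₀(M)` along the embedding `L(A₀[N]) → M` through which `e` factors.  (Shimura p. 167: «a finite Galois extension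
… over which … the points of `A[N]` are rational».) [cite: Shimura1998, §18.6 proof of Thm. 18.6, p. 167]
[cite: Shimura1998, §19.1] [cite: SerreTate1968, §1] -/
theorem exists_intermediateField_forall_torsionPoints_complex_of_subset_range (hN : N ≠ 0) :
    ∃ L' : IntermediateField L ℂ, FiniteDimensional L L' ∧ IsGalois L L' ∧
      ∀ (M : Type) [Field M] [Algebra L M] [Algebra M ℂ] [IsScalarTower L M ℂ],
        (L' : Set ℂ) ⊆ Set.range (algebraMap M ℂ) →
        ∀ P ∈ A₀.torsionPoints ℂ (N : ℤ),
          ∃ Q ∈ A₀.torsionPoints M (N : ℤ), AlgPoints.extendScalars A₀.X M ℂ Q = P := by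
  classical
  haveI : NeZero N := ⟨hN⟩
  -- an `L`-embedding `e : L̄ → ℂ`, used as the algebra structure `L̄ → ℂ`
  let e : AlgebraicClosure L →ₐ[L] ℂ := IsAlgClosed.lift
  letI : Algebra (AlgebraicClosure L) ℂ := (e : AlgebraicClosure L →+* ℂ).toAlgebra
  haveI : IsScalarTower L (AlgebraicClosure L) ℂ :=
    IsScalarTower.of_algebraMap_eq fun x => (e.commutes x).symm
  have he : ∀ x : AlgebraicClosure L, algebraMap (AlgebraicClosure L) ℂ x = e x := fun _ => rfl
  -- the division field `D = L(A₀[N]) ⊆ L̄` and its image `L′ = e(D) ⊆ ℂ`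
  set D : IntermediateField L (AlgebraicClosure L) := A₀.divisionField N with hD
  refine ⟨D.map e, LinearEquiv.finiteDimensional (D.equivMap e).toLinearEquiv, IsGalois.of_algEquiv (D.equivMap e), ?_⟩
  intro M _ _ _ _ hM P hP
  -- `P = (Q₀)_ℂ`, `Q₀ ∈ A₀[N](L̄)`; `Q₀ = (Q₁)_{L̄}`, `Q₁ ∈ A₀[N](D)`
  have hNL : ((N : ℤ) : L) ≠ 0 := by exact_mod_cast hN
  obtain ⟨Q₀, hQ₀, rfl⟩ := A₀.exists_extendScalars_eq_of_mem_torsionPoints ℂ hNL hP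
  obtain ⟨Q₁, -, rfl⟩ := A₀.exists_extendScalars_eq_of_divisionField_le N (le_of_eq hD.symm) hQ₀
  -- the `L`-embedding `j : D → M` with `(M → ℂ) ∘ j = e|_D`
  have key : ∀ x : D, ∃ y : M, algebraMap M ℂ y = e x := fun x =>
    hM (by rw [IntermediateField.coe_map]; exact ⟨x, x.2, rfl⟩)
  choose g hg using key
  have hinj : Function.Injective (algebraMap M ℂ) := (algebraMap M ℂ).injective
  let j : D →ₐ[L] M :=
    { toFun := g
      map_one' := hinj (by rw [hg, OneMemClass.coe_one, map_one, map_one])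
      map_mul' := fun x y => hinj (by rw [hg, MulMemClass.coe_mul, map_mul, map_mul, hg, hg])
      map_zero' := hinj (by rw [hg, ZeroMemClass.coe_zero, map_zero, map_zero])
      map_add' := fun x y => hinj (by rw [hg, AddMemClass.coe_add, map_add, map_add, hg, hg])
      commutes' := fun c => hinj (by
        rw [hg, ← IsScalarTower.algebraMap_apply L M ℂ c, IntermediateField.coe_algebraMap_apply, e.commutes]) }
  have hj : ∀ x : D, algebraMap M ℂ (j x) = e x := hg
  -- the `M`-point and the equation `(Q)_ℂ = ((Q₁)_{L̄})_ℂ`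
  have heq : AlgPoints.extendScalars A₀.X M ℂ (AlgPoints.specOverMapOfAlgHom j ≫ Q₁) =
      AlgPoints.extendScalars A₀.X (AlgebraicClosure L) ℂ
        (AlgPoints.extendScalars A₀.X D (AlgebraicClosure L) Q₁) := by
    have hρ : (algebraMap M ℂ).comp j.toRingHom =
        (algebraMap (AlgebraicClosure L) ℂ).comp (algebraMap D (AlgebraicClosure L)) := by
      ext x
      change algebraMap M ℂ (j x) = algebraMap (AlgebraicClosure L) ℂ (algebraMap D (AlgebraicClosure L) x)
      rw [hj, he, IntermediateField.algebraMap_apply]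
    apply Over.OverMorphism.ext
    change Spec.map (CommRingCat.ofHom (algebraMap M ℂ)) ≫ Spec.map (CommRingCat.ofHom j.toRingHom) ≫ Q₁.left =
      Spec.map (CommRingCat.ofHom (algebraMap (AlgebraicClosure L) ℂ)) ≫
        Spec.map (CommRingCat.ofHom (algebraMap D (AlgebraicClosure L))) ≫ Q₁.left
    rw [← Spec.map_comp_assoc, ← Spec.map_comp_assoc, ← CommRingCat.ofHom_comp, ← CommRingCat.ofHom_comp, hρ]
  refine ⟨AlgPoints.specOverMapOfAlgHom j ≫ Q₁, A₀.mem_torsionPoints_of_extendScalars_mem M ℂ ?_, heq⟩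
  rw [heq]
  exact hP

/-- **Torsion points of `A₀(ℂ)` are rational over a finite Galois extension of `L` inside `ℂ` — intermediate-field
form, upward closed.**  For `A₀` over a field `L ⊂ ℂ` of characteristic `0` and `N ≠ 0` there is
`L′ : IntermediateField L ℂ`, finite and Galois over `L`, such that for every intermediate field `M ⊇ L′` every
`P ∈ A₀[N](ℂ)` is `Q_ℂ` for some `Q ∈ A₀[N](M)` — «a finite Galois extension … over which … the points of `A[N]` are
rational», with room to enlarge the field (S7a-G1's common field `L₁ ⊇ L′`).
[cite: Shimura1998, §18.6 proof of Thm. 18.6, p. 167] [cite: Shimura1998, §19.1] [cite: SerreTate1968, §1] -/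
theorem exists_intermediateField_forall_torsionPoints_complex (hN : N ≠ 0) :
    ∃ L' : IntermediateField L ℂ, FiniteDimensional L L' ∧ IsGalois L L' ∧
      ∀ M : IntermediateField L ℂ, L' ≤ M →
        ∀ P ∈ A₀.torsionPoints ℂ (N : ℤ),
          ∃ Q ∈ A₀.torsionPoints M (N : ℤ), AlgPoints.extendScalars A₀.X M ℂ Q = P := by
  obtain ⟨L', h₁, h₂, h₃⟩ := A₀.exists_intermediateField_forall_torsionPoints_complex_of_subset_range hN
  refine ⟨L', h₁, h₂, fun M hM => h₃ M fun x hx => ⟨⟨x, hM hx⟩, rfl⟩⟩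

end Complex

end AbelianVariety

end Literature.AlgebraicGeometry.Motives

end
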